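import Mathlib.Algebra.BigOperators.Fin
import Mathlib.Logic.Equiv.Fin.Basic
import Literature.NumberTheory.Transcendental.KZVolumeConjectureProofs

/-!
# OffTetraSectorKernel (stmt-KontsevichZagierPeriods-10557), line odd-hyperbolic-ladder: stub stub_divisibleOfDistribution

Bookkeeping + soundness: the DISTRIBUTION RELATIONS make the Bloch–Wigner oracle DIVISIBLE.

Fix the tetrahedral carrier `T` and call a family `ρ : ℂ → KZ.IntegralRep 3` *admissible* if, at every
algebraic point `z` of the upper half plane, `ρ z` has domain `T z` and integrand `p ↦ 1 / (p 2)³` on it.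
A *tetrahedral value-relator* is a formal combination `d = Σᵢ nᵢ • [ρ zᵢ]` (admissible `ρ`, algebraic
`zᵢ ∈ ℍ⁺`, `nᵢ ∈ ℤ`) whose value-sum `Σᵢ nᵢ · vol(ρ zᵢ)` vanishes.

HYPOTHESIS (the distribution relations, proved by the lead from the neighbouring stubs): for every
admissible `ρ`, every `k ≥ 1` and every algebraic `z ∈ ℍ⁺` there are algebraic points
`u₀, …, u_{k−1} ∈ ℍ⁺` and signs `ε₀, …, ε_{k−1} ∈ ℤ` with `[ρ z] − k • Σⱼ εⱼ • [ρ uⱼ] ∈ KZ.relations`.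

CONCLUSION: every tetrahedral value-relator `d = Σᵢ nᵢ • [ρ zᵢ]` is `≡ k • d′` modulo `KZ.relations`
for the tetrahedral value-relator `d′ = Σᵢ Σⱼ (nᵢ εᵢⱼ) • [ρ uᵢⱼ]` over the SAME family `ρ`, re-indexed
over `Fin (m * k)` along `finProdFinEquiv`.  Two points:
* `d − k • d′ = Σᵢ nᵢ • ([ρ zᵢ] − k • Σⱼ εᵢⱼ • [ρ uᵢⱼ])` is a `ℤ`-combination of relations;
* the value-sum of `d′` vanishes by SOUNDNESS of the calculus (`KZ.eval` kills `KZ.relations`,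
  `KZ.eval_eq_zero_of_mem_relations`, and `KZ.eval [r] = vol r`, `KZ.eval_of`):
  `k · eval d′ = eval d = Σᵢ nᵢ · vol(ρ zᵢ) = 0` and `k ≠ 0`.

References: M. Kontsevich, D. Zagier, *Periods* (2001), §1.2 (the moves and their soundness).
-/

noncomputable section

open Set MeasureTheory
open Literature.NumberTheory.Transcendental

namespace Summit.KontsevichZagierPeriods.HyperbolicBloch.OffTetraSectorKernel

/-- Soundness on value-relators: `KZ.eval (Σᵢ nᵢ • [rᵢ]) = Σᵢ nᵢ · vol rᵢ`.
[cite: KontsevichZagier2001, §1.2] -/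
theorem divisibleOfDistribution_eval_sum {ι : Type*} (s : Finset ι) (n : ι → ℤ)
    (r : ι → KZ.IntegralRep 3) :
    KZ.eval (∑ i ∈ s, n i • KZ.of (r i)) = ∑ i ∈ s, (n i : ℝ) * (r i).value := by
  rw [map_sum]
  refine Finset.sum_congr rfl fun i _ => ?_
  rw [map_zsmul, KZ.eval_of, zsmul_eq_mul]

/-- Re-indexing a double sum over `Fin m × Fin k` as a single sum over `Fin (m * k)` along
`finProdFinEquiv`. [cite: KontsevichZagier2001, §1.2] -/
theorem divisibleOfDistribution_sum_reindex {M : Type*} [AddCommMonoid M] {m k : ℕ}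
    (F : Fin m → Fin k → M) :
    ∑ l : Fin (m * k), F (finProdFinEquiv.symm l).1 (finProdFinEquiv.symm l).2 =
      ∑ i, ∑ j, F i j := by
  rw [← Fintype.sum_prod_type']
  exact finProdFinEquiv.symm.sum_comp (fun p : Fin m × Fin k => F p.1 p.2)

/-- The scalar bookkeeping `k • (n * ε) • x = n • k • ε • x` between the `ℕ`- and `ℤ`-actions on an
additive commutative group. [cite: KontsevichZagier2001, §1.2] -/
theorem divisibleOfDistribution_smul_comm {M : Type*} [AddCommGroup M] (k : ℕ) (n ε : ℤ) (x : M) :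
    k • (n * ε) • x = n • k • ε • x := by
  rw [mul_smul, smul_comm]

/-- STUB `stub_divisibleOfDistribution` (bookkeeping + soundness): the distribution relations make the
oracle divisible — given `[ρ zᵢ] ≡ k · Σⱼ εᵢⱼ [ρ uᵢⱼ]`, a value-relator `d = Σ nᵢ [ρ zᵢ]` is `≡ k · d′` with
`d′ = Σᵢⱼ nᵢ εᵢⱼ [ρ uᵢⱼ]` (re-indexed over `Fin (m·k)` by `finProdFinEquiv`), and
`Σ nᵢ εᵢⱼ vol(ρ uᵢⱼ) = eval d′ = eval d / k = 0` by SOUNDNESS (`KZ.eval_eq_zero_of_mem_relations`,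
`KZ.eval_of`). [cite: KontsevichZagier2001, §1.2] -/
theorem stub_divisibleOfDistribution :
    ∀ (T : ℂ → Set (Fin 3 → ℝ)),
    (∀ (ρ : ℂ → KZ.IntegralRep 3), (∀ z, IsAlgebraic ℚ z → 0 < z.im → (ρ z).domain = T z ∧
        Set.EqOn (ρ z).integrand (fun p => 1 / p 2 ^ 3) (T z)) →
      ∀ (k : ℕ), 1 ≤ k → ∀ (z : ℂ), IsAlgebraic ℚ z → 0 < z.im →
        ∃ (u : Fin k → ℂ) (ε : Fin k → ℤ), (∀ j, IsAlgebraic ℚ (u j)) ∧ (∀ j, 0 < (u j).im) ∧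
          KZ.of (ρ z) - k • ∑ j, ε j • KZ.of (ρ (u j)) ∈ KZ.relations) →
    ∀ (k : ℕ), 1 ≤ k → ∀ d ∈ {d : KZ.FormalRep | ∃ ρ : ℂ → KZ.IntegralRep 3, (∀ z, IsAlgebraic ℚ z → 0 < z.im → (ρ z).domain = T z ∧ Set.EqOn (ρ z).integrand (fun p => 1 / p 2 ^ 3) (T z)) ∧ ∃ (k : ℕ) (z : Fin k → ℂ) (n : Fin k → ℤ), (∀ i, IsAlgebraic ℚ (z i)) ∧ (∀ i, 0 < (z i).im) ∧ ∑ i, (n i : ℝ) * (ρ (z i)).value = 0 ∧ d = ∑ i, n i • KZ.of (ρ (z i))},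
      ∃ d' ∈ {d : KZ.FormalRep | ∃ ρ : ℂ → KZ.IntegralRep 3, (∀ z, IsAlgebraic ℚ z → 0 < z.im → (ρ z).domain = T z ∧ Set.EqOn (ρ z).integrand (fun p => 1 / p 2 ^ 3) (T z)) ∧ ∃ (k : ℕ) (z : Fin k → ℂ) (n : Fin k → ℤ), (∀ i, IsAlgebraic ℚ (z i)) ∧ (∀ i, 0 < (z i).im) ∧ ∑ i, (n i : ℝ) * (ρ (z i)).value = 0 ∧ d = ∑ i, n i • KZ.of (ρ (z i))}, d - k • d' ∈ KZ.relations := by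
  intro T hdist k hk d hd
  obtain ⟨ρ, hρ, m, z, n, hz, hzim, hval, rfl⟩ := hd
  choose u ε hu hε hrel using fun i => hdist ρ hρ k hk (z i) (hz i) (hzim i)
  -- the re-indexed candidate `d′ = Σ_l n′ l • [ρ (z′ l)]` over `Fin (m * k)`
  have hsum : ∑ l : Fin (m * k), (n (finProdFinEquiv.symm l).1 *
        ε (finProdFinEquiv.symm l).1 (finProdFinEquiv.symm l).2) •
        KZ.of (ρ (u (finProdFinEquiv.symm l).1 (finProdFinEquiv.symm l).2)) =
      ∑ i, ∑ j, (n i * ε i j) • KZ.of (ρ (u i j)) :=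
    divisibleOfDistribution_sum_reindex (fun i j => (n i * ε i j) • KZ.of (ρ (u i j)))
  -- (b) `d − k • d′` is a `ℤ`-combination of the distribution relations
  have hkey : ∑ i, n i • KZ.of (ρ (z i)) - k • ∑ l : Fin (m * k), (n (finProdFinEquiv.symm l).1 *
        ε (finProdFinEquiv.symm l).1 (finProdFinEquiv.symm l).2) •
        KZ.of (ρ (u (finProdFinEquiv.symm l).1 (finProdFinEquiv.symm l).2)) ∈ KZ.relations := by
    rw [hsum, Finset.smul_sum, ← Finset.sum_sub_distrib]
    refine AddSubgroup.sum_mem _ fun i _ => ?_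
    have hi : n i • KZ.of (ρ (z i)) - k • ∑ j, (n i * ε i j) • KZ.of (ρ (u i j)) =
        n i • (KZ.of (ρ (z i)) - k • ∑ j, ε i j • KZ.of (ρ (u i j))) := by
      simp only [smul_sub, Finset.smul_sum, divisibleOfDistribution_smul_comm]
    rw [hi]
    exact AddSubgroup.zsmul_mem _ (hrel i) _
  refine ⟨_, ⟨ρ, hρ, m * k,
    fun l => u (finProdFinEquiv.symm l).1 (finProdFinEquiv.symm l).2,
    fun l => n (finProdFinEquiv.symm l).1 * ε (finProdFinEquiv.symm l).1 (finProdFinEquiv.symm l).2,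
    fun l => hu _ _, fun l => hε _ _, ?_, rfl⟩, hkey⟩
  -- (c) the value-sum of `d′` vanishes by soundness
  have hd0 : KZ.eval (∑ i, n i • KZ.of (ρ (z i))) = 0 := by
    rw [divisibleOfDistribution_eval_sum]; exact hval
  have h0 := KZ.eval_eq_zero_of_mem_relations hkey
  rw [map_sub, hd0, zero_sub, neg_eq_zero, map_nsmul, nsmul_eq_mul, mul_eq_zero] at h0
  have hk0 : (k : ℝ) ≠ 0 := Nat.cast_ne_zero.mpr (by omega)
  rw [← divisibleOfDistribution_eval_sum]
  exact h0.resolve_left hk0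

end Summit.KontsevichZagierPeriods.HyperbolicBloch.OffTetraSectorKernel
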